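import Literature.MathematicalPhysics.QuantumFieldTheory.Balaban1983to89.B9Eq371CoCurlLeibnizY
import Literature.MathematicalPhysics.QuantumFieldTheory.Balaban1983to89.Node00.OpsYCurlGrad
import Literature.MathematicalPhysics.QuantumFieldTheory.Balaban1983to89.B9Eq3117Current

/-!
# `Balaban1983to89.B9Eq375GradDivSplitY` — [B9] (3.74)–(3.75) p. 405 AT def-Y'S LETTERS: THE GRADIENT–DIVERGENCE WORD `D₁D*₁ − D_VD*_V` OF THE PROJECTION PIECE IS A
# LOCAL FIRST-ORDER OPERATOR IN THE FLAT BOND DERIVATIVES, `D₁D*₁ − D_VD*_V = P⁰_V + Σ_ν P¹_{V,ν}∘∇_ν`, with EXPLICIT letters `P0Y`, `P1Y` (print's `V₂(A)` of (3.75), the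
# gradient–divergence half of `V₃(A)` in (3.82)), and its realification `conj b((D₁D*₁ − D_VD*_V)^ℝ) = conj b(P⁰^ℝ) + Σ_ν conj b(P¹_ν^ℝ)·DK b i ν` (sub-row G-B9-LETTERS,
# module M5.1b-G, FILE G-F5b part I; identities only, no estimates)

T. Bałaban, *Propagators for lattice gauge theories in a background field*, Commun. Math. Phys. **99** (1985) 389–434
[`Balaban1985BackgroundPropagators`, "B9"]; [4] = Commun. Math. Phys. **96** (1984) 223–250 [`Balaban1984PropagatorsII`].

statement-level skeleton of published theorems with citation tags; proofs where landed; nothing here is a claim about the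
Yang–Mills mass gap

THE PRINTED LOCUS (verbatim, held `paper:balaban1985-cmp99-background-propagators` p0017 = p. 405; page owner r06).  *«Next we consider the operator DRD\*. We have
discussed already the expansion (3.68) of the operator P(U′U), so we have to consider the differential operators again. We have (D\*_{U′U}A′)(x) = (D\*_UA′)(x) +
Σ_ν η⁻¹[exp(−ηi ad_{R(U(x,x−ηe_ν))A_ν(x−ηe_ν)}) − 1]R(U(x, x − ηe_ν))A′_ν(x − ηe_ν), (3.74)  (D_{U′U}D\*_{U′U}A′)_μ(x) = (D_UD\*_UA′)_μ(x) − Σ_ν[− i ad_{A_μ(x)}R(U(x,x+ηe_μ))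
(D\*A′)(x+ηe_μ) + … − i ad_{A_ν(x)}(D\*_μA′_ν)(x) + i ad_{A_ν(x)}(D_μA′_ν)(x) + i ad_{(D_μA_ν)}(x)R(U(x,x+ηe_μ))A′_ν(x+ηe_μ) + …] − (F_{2,k}(A)A′)_μ(x) = (DD\*A′)_μ(x) −
(V₂(A)A′)_μ(x), (3.75) where the operators F_{2,k}(A), V₂(A) satisfy the bounds (3.72), (3.73).»*; p. 407 (3.82): *«Δ_a(U′U) = … = Δ_a(U) − V₃(A) − P₁(A) − P₂(A).
The operator V₃(A) is a local differential operator of the first order satisfying the bound (3.73).»* (so `V₂ ⊂ V₃`).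

WHY THIS FILE (cell `lit-balaban`, sub-row G-B9-LETTERS; module M5.1b-G = Cor. 3.5∕3.6 for the BOND-sector cube letter `G_□ = Δ_{a,□}⁻¹`).  G-F5's assembly
`B9Cor35GAtCubeLetters.cor35_G_cube_of_pieces` (p645320) split the (3.84) remainder BY LETTER; its projection piece `projPieceK b i □ parS V = conj b((D₁R_□(1)D*₁ −
D_VR_□(V)D*_V)^ℝ)` with `R_□ = 1 − P_□` contains, besides print's non-local `P₁(A)` ((3.76)–(3.77), zeroth order), the LOCAL FIRST-ORDER word `D₁D*₁ − D_VD*_V = V₂(A)` of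
(3.75), whose majorant has the (3.73)-shape `α₁((Lⁿη)⁻¹|∇X| + (Lⁿη)⁻²|X|)` — NOT the zeroth-order shape `κ₁α₁(Lⁿη)⁻²` of G-F5's displayed `hPr` (a zeroth-order majorant of a
first-order word costs the factor `Lⁿ`).  THIS FILE is the gradient–divergence twin of G-F5a parts I–II (`B9Eq371HessianSplitY`, `B9Eq371CoCurlLeibnizY`): with
`E := D_V − D₁` (zeroth order, (3.70) on sites: `(EΛ)(⟨x,κ⟩) = c_f(R(V_κ(x)) − 1)Λ(x+e_κ)`) and `E* := D*_V − D*₁` ((3.74): `(E*A)(x) = c_fΣ_μ(R(V_μ(x−e_μ))⁻¹ − 1)A(⟨x−e_μ,μ⟩)`),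
`D₁D*₁ − D_VD*_V = −E∘D*₁ − D₁∘E* − E∘E*` (ring algebra); `E∘D*₁` is first order as it stands (`D*₁ = −Σ_μ S_{−μ}∘(·)_μ∘∇_μ`); `D₁∘E*` needs the product rule of (3.75)
(the outer flat difference falls on the coefficient → the VARIATION `R(V_μ(y+e_κ))⁻¹ − R(V_μ(y))⁻¹`, print's `i ad_{(D_μA_ν)}` term, or on `A` → `(R(V)⁻¹ − 1)·∇_κA`, print's
`i ad_A·(D_μA′_ν)` terms); `E∘E*` is a product of two small factors.  Result: ★★★ `gradDiv_one_sub_gradDiv_eq`: `D₁D*₁ − D_VD*_V = P0Y V + Σ_ν P1Y V ν ∘ₗ nablaY ν` with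
explicit stencil letters, and its realification in G-F5's currency.  The ESTIMATES ((3.73)-sized majorants of `conj b(P0Y^ℝ)`, `conj b(P1Y ν^ℝ)` from the windows) are
part II; the generalised assembly taking the projection piece in the form `P⁰ + Σ_ν P¹_ν·DK ν + P₁` is filed with it.

WHAT THIS FILE PROVES (THEOREMS + `def`s with bodies: `EgY`, `EdY`, `P1aY`, `P0aY`, `P1bY`, `P0Y`, `P1Y`; 0 `def … : Prop`, 0 sorry).
* §1 pointwise forms on torus sites: `gradY_one_apply_mk`, ★ `divY_apply_chartY` (`(D*_VA)(x) = c_fΣ_μ(R(V_μ(x−e_μ))⁻¹A(x−e_μ,μ) − A(x,μ))`), `divY_one_apply_chartY`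
  (`D*₁A(x) = −Σ_μ(∇_μA)(⟨x−e_μ,μ⟩)`), the letters `EgY V := gradY V − gradY 1`, `EdY V := divY V − divY 1` and their pointwise forms `EgY_apply_mk`, `EdY_apply_chartY`,
  `gradDiv_one_sub_gradDiv_eq_neg` (`D₁D*₁ − D_VD*_V = −E∘D*₁ − D₁∘E* − E∘E*`).
* §2 `P1aY V ν` (`c_f(R(V_κ(x)) − 1)` on `Y(x+e_κ−e_ν, ν)`), ★ `EgY_comp_divY_one` (`E∘D*₁ = −Σ_ν P1aY ν∘∇_ν`); `P0aY V` (the variation word, factor `c_f²`), `P1bY V ν`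
  (`[ν = κ]·c_fΣ_μ(R(V_μ(x−e_μ))⁻¹ − 1)` on `Y(x−e_μ, μ)`), ★★ `gradY_one_comp_EdY` (the product rule: `D₁∘E* = −P0aY − Σ_ν P1bY ν∘∇_ν`).
* §3 `P0Y V := P0aY V − EgY V∘EdY V`, `P1Y V ν := P1aY V ν + P1bY V ν`, ★★★ `gradDiv_one_sub_gradDiv_eq` (`gradY 1∘divY 1 − gradY V∘divY V = P0Y V + Σ_ν P1Y V ν∘nablaY ν`),
  ★★★ `conj_gradDiv_one_sub_gradDiv_eq` (realified: `conj b((…)^ℝ) = conj b(P0Y^ℝ) + Σ_ν conj b(P1Y ν^ℝ)·DK b i ν`).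

HONEST SCOPE.  Exact identities (finite-difference algebra on the torus; def-Y's `gradY`/`divY` via `gradY_apply_mk`/`divY_apply_eq_sum_cdsS`, G-F5a's `nablaY`,
`unshift_shift_comm`, `R_finset_sum`); no estimate, no window, no majorant; the non-local `P₁(A)` of (3.76) is NOT here.  Count-neutral; NOT a node discharge; no summit ∕
sub-problem statement is proved; nothing continuum ∕ OS ∕ mass-gap ∕ Clay; YM mass gap NOT proved by any of this (Track A conditional rung).  No `sorry`, no `axiom`, no
`… : Prop` fact, no `instance`, no `notation`.  NEW file; nothing landed is modified.  Cell `lit-balaban`, seat `lit-balaban-p38` gen 43, 2026-08-28;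
`--supports stmt-QuantumFields-19200`.  Net new unproved facts: 0.

RELATED IN THE TREE, NOT DUPLICATED: G-F5a I–II (`B9Eq371HessianSplitY`, `B9Eq371CoCurlLeibnizY` — the Hessian twin; `nablaY`, `unshift_shift_comm`, `conj_finset_sum` USED),
r06's torus-letter (3.74)–(3.75) (`B9Eq376POneLetters.gradLin`/`divLin`, `B9Eq375Composition`, `B9Eq375GradLetters` — generic carriers `κ × S`, abstract backgrounds; not def-Y's
`FBondY` letters), cell pub-balaban's `B9Eq375BondGradDivTwoBackgroundSplit` (pointwise-with-norms model on `B9Eq34CovCurlVector`'s carriers), p38's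
`B9Eq3104CommutatorGradFormDD` (`gradY U∘divY U` through `cdS∘cdsS`, one background).
-/

noncomputable section

namespace Literature.MathematicalPhysics.QuantumFieldTheory.Balaban1983to89.B9Eq375GradDivSplitY

open Node00
open Literature.MathematicalPhysics.QuantumFieldTheory.Balaban1983to89
open Literature.MathematicalPhysics.QuantumFieldTheory.Balaban1983to89.B6KLevelCensusIndexV1 (KIdx)
open Literature.MathematicalPhysics.QuantumFieldTheory.Balaban1983to89.B6GlobalChartV1 (PV)
open Literature.MathematicalPhysics.QuantumFieldTheory.Balaban1983to89.B9Eq39Adjoint (R R_add R_sub R_smul R_one R_neg)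
open Literature.MathematicalPhysics.QuantumFieldTheory.Balaban1983to89.B9Eq3117Current (R_finset_sum)
open Literature.MathematicalPhysics.QuantumFieldTheory.Balaban1983to89.B9Eq371HessianSplitY (nablaY nablaY_apply)
open Literature.MathematicalPhysics.QuantumFieldTheory.Balaban1983to89.B9Eq371CoCurlLeibnizY (unshift_shift_comm conj_add'' conj_finset_sum)
open Literature.MathematicalPhysics.QuantumFieldTheory.Balaban1983to89.B9Cor35GCubeInputsAtOne (DK)
open Literature.MathematicalPhysics.QuantumFieldTheory.Balaban1983to89.Node00.OpsYNablaBridge (chartY shiftY_chartY shiftY_symm_chartY shift_unshift unshift_shift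
  divY_apply_eq_sum_cdsS bondCompY_apply cdsS_apply)
open Literature.MathematicalPhysics.QuantumFieldTheory.Balaban1983to89.Node00.OpsYCurlGrad (gradY_apply_mk)

variable {d ℓ : ℕ} {hd : 1 ≤ d + 1} {hL : Odd (ℓ + 1) ∧ 1 < ℓ + 1} {b₀ b₁ : ℝ}
variable {𝔸 : Type} [NormedRing 𝔸] [NormedAlgebra ℂ 𝔸] [CompleteSpace 𝔸]
variable (i : KIdx d ℓ hd hL b₀ b₁)

/-! ## §1  `D_U`, `D*_U` pointwise on torus sites; the first-order differences `E = D_V − D₁`, `E* = D*_V − D*₁`; the three-term split -/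

/-- (3.3) at `U = 1` in torus coordinates: `(D₁Λ)(⟨s, κ⟩) = c_f·(Λ̂(s + e_κ) − Λ̂(s))`. [cite: Balaban1985BackgroundPropagators, (3.3) p.390 at U = 1] -/
theorem gradY_one_apply_mk (Λ : SiteY i → 𝔸) (s : Site (PV d ℓ i.m i.K hd hL) 0) (κ : Fin (d + 1)) :
    gradY i (fun _ _ => (1 : 𝔸ˣ)) Λ ⟨s, κ⟩ = ((i.cf : ℝ) : ℂ) • (Λ (chartY i (s.shift κ)) - Λ (chartY i s)) := by
  rw [gradY_apply_mk, R_one]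

/-- ★ **(3.8) in torus coordinates**: `(D*_VA)(x) = c_f·Σ_μ (R(V_μ(x − e_μ))⁻¹A(⟨x − e_μ, μ⟩) − A(⟨x, μ⟩))` (transport from the initial point `x − e_μ` of the bond back to
`x`). [cite: Balaban1985BackgroundPropagators, (3.8) p.392] -/
theorem divY_apply_chartY (V : CfgY 𝔸 i) (A : FBondY i → 𝔸) (w : Site (PV d ℓ i.m i.K hd hL) 0) :
    divY i V A (chartY i w) = ((i.cf : ℝ) : ℂ) • ∑ μ : Fin (d + 1), (R (V μ (w.unshift μ))⁻¹ (A ⟨w.unshift μ, μ⟩) - A ⟨w, μ⟩) := by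
  rw [divY_apply_eq_sum_cdsS]
  congr 1
  refine Finset.sum_congr rfl fun μ _ => ?_
  rw [cdsS_apply, shiftY_symm_chartY, bondCompY_apply, bondCompY_apply, Equiv.symm_apply_apply, Equiv.symm_apply_apply]

/-- **`D*₁` IS FIRST ORDER IN THE FLAT BOND DERIVATIVES**: `(D*₁A)(x) = −Σ_μ (∇_μA)(⟨x − e_μ, μ⟩)`. [cite: Balaban1985BackgroundPropagators, (3.8) p.392 at U = 1] -/
theorem divY_one_apply_chartY (A : FBondY i → 𝔸) (w : Site (PV d ℓ i.m i.K hd hL) 0) :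
    divY i (fun _ _ => (1 : 𝔸ˣ)) A (chartY i w) = -∑ μ : Fin (d + 1), nablaY i μ A ⟨w.unshift μ, μ⟩ := by
  rw [divY_apply_chartY, Finset.smul_sum, ← Finset.sum_neg_distrib]
  refine Finset.sum_congr rfl fun μ _ => ?_
  rw [inv_one, R_one, nablaY_apply]
  change _ = -(((i.cf : ℝ) : ℂ) • (A ⟨(w.unshift μ).shift μ, μ⟩ - A ⟨w.unshift μ, μ⟩))
  rw [shift_unshift, ← smul_neg, neg_sub]

/-- **the first-order difference of the gradients, `E := D_V − D₁`** ((3.70) on site functions: the `η⁻¹(exp ηi ad_A − 1)R(U)`-term, here exact with `R(V) − 1`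
unexpanded). [cite: Balaban1985BackgroundPropagators, (3.70) p.404, (3.3) p.390] -/
def EgY (V : CfgY 𝔸 i) : (SiteY i → 𝔸) →ₗ[ℂ] (FBondY i → 𝔸) := gradY i V - gradY i (fun _ _ => 1)

/-- **the first-order difference of the divergences, `E* := D*_V − D*₁`** ((3.74)). [cite: Balaban1985BackgroundPropagators, (3.74) p.405, (3.8) p.392] -/
def EdY (V : CfgY 𝔸 i) : (FBondY i → 𝔸) →ₗ[ℂ] (SiteY i → 𝔸) := divY i V - divY i (fun _ _ => 1)

/-- `E` pointwise: `(EΛ)(⟨s, κ⟩) = c_f·(R(V_κ(s))Λ̂(s+e_κ) − Λ̂(s+e_κ))`. [cite: Balaban1985BackgroundPropagators, (3.70) p.404] -/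
theorem EgY_apply_mk (V : CfgY 𝔸 i) (Λ : SiteY i → 𝔸) (s : Site (PV d ℓ i.m i.K hd hL) 0) (κ : Fin (d + 1)) :
    EgY i V Λ ⟨s, κ⟩ = ((i.cf : ℝ) : ℂ) • (R (V κ s) (Λ (chartY i (s.shift κ))) - Λ (chartY i (s.shift κ))) := by
  rw [EgY, LinearMap.sub_apply, Pi.sub_apply, gradY_apply_mk, gradY_one_apply_mk, ← smul_sub]
  congr 1
  abel

/-- `E*` pointwise: `(E*A)(x) = c_f·Σ_μ (R(V_μ(x−e_μ))⁻¹A(⟨x−e_μ, μ⟩) − A(⟨x−e_μ, μ⟩))`. [cite: Balaban1985BackgroundPropagators, (3.74) p.405] -/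
theorem EdY_apply_chartY (V : CfgY 𝔸 i) (A : FBondY i → 𝔸) (w : Site (PV d ℓ i.m i.K hd hL) 0) :
    EdY i V A (chartY i w) = ((i.cf : ℝ) : ℂ) • ∑ μ : Fin (d + 1), (R (V μ (w.unshift μ))⁻¹ (A ⟨w.unshift μ, μ⟩) - A ⟨w.unshift μ, μ⟩) := by
  rw [EdY, LinearMap.sub_apply, Pi.sub_apply, divY_apply_chartY, divY_apply_chartY, ← smul_sub, ← Finset.sum_sub_distrib]
  congr 1
  refine Finset.sum_congr rfl fun μ _ => ?_
  rw [inv_one, R_one]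
  abel

/-- **THE THREE-TERM SPLIT** (ring algebra): `D₁D*₁ − D_VD*_V = −E∘D*₁ − D₁∘E* − E∘E*`. [cite: Balaban1985BackgroundPropagators, (3.75)–(3.76) p.405] -/
theorem gradDiv_one_sub_gradDiv_eq_neg (V : CfgY 𝔸 i) :
    gradY i (fun _ _ => (1 : 𝔸ˣ)) ∘ₗ divY i (fun _ _ => 1) - gradY i V ∘ₗ divY i V =
      -(EgY i V ∘ₗ divY i (fun _ _ => 1)) - gradY i (fun _ _ => 1) ∘ₗ EdY i V - EgY i V ∘ₗ EdY i V := by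
  simp only [EgY, EdY, LinearMap.sub_comp, LinearMap.comp_sub]
  abel

/-! ## §2  `E∘D*₁` is first order; the product rule for `D₁∘E*` -/

/-- **the `V¹`-words of `−E∘D*₁`**: `(P1a_νY)(⟨s, κ⟩) = c_f·(R(V_κ(s))Y(⟨s+e_κ−e_ν, ν⟩) − Y(⟨s+e_κ−e_ν, ν⟩))` (to be composed with `∇_ν`; print's `i ad_{A_μ(x)}R(U)(D*A′)(x+ηe_μ)`
term of (3.75)). [cite: Balaban1985BackgroundPropagators, (3.75) p.405, (3.73) p.405] -/
def P1aY (V : CfgY 𝔸 i) (ν : Fin (d + 1)) : (FBondY i → 𝔸) →ₗ[ℂ] (FBondY i → 𝔸) where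
  toFun Y := fun b => ((i.cf : ℝ) : ℂ) •
    (R (V b.dir b.src) (Y ⟨(b.src.shift b.dir).unshift ν, ν⟩) - Y ⟨(b.src.shift b.dir).unshift ν, ν⟩)
  map_add' Y Y' := by
    funext b
    simp only [Pi.add_apply, R_add, ← smul_add]
    congr 1; abel
  map_smul' c Y := by
    funext b
    simp only [Pi.smul_apply, R_smul, RingHom.id_apply]
    rw [smul_comm c]; simp only [smul_sub]

/-- `P1a_ν` evaluated. [cite: Balaban1985BackgroundPropagators, (3.75) p.405, bookkeeping] -/
theorem P1aY_apply (V : CfgY 𝔸 i) (ν : Fin (d + 1)) (Y : FBondY i → 𝔸) (b : FBondY i) :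
    P1aY i V ν Y b = ((i.cf : ℝ) : ℂ) • (R (V b.dir b.src) (Y ⟨(b.src.shift b.dir).unshift ν, ν⟩) - Y ⟨(b.src.shift b.dir).unshift ν, ν⟩) := rfl

/-- `P1a_ν` evaluated at `⟨s, κ⟩`. [cite: Balaban1985BackgroundPropagators, (3.75) p.405, bookkeeping] -/
theorem P1aY_apply_mk (V : CfgY 𝔸 i) (ν : Fin (d + 1)) (Y : FBondY i → 𝔸) (s : Site (PV d ℓ i.m i.K hd hL) 0) (κ : Fin (d + 1)) :
    P1aY i V ν Y ⟨s, κ⟩ = ((i.cf : ℝ) : ℂ) • (R (V κ s) (Y ⟨(s.shift κ).unshift ν, ν⟩) - Y ⟨(s.shift κ).unshift ν, ν⟩) := rfl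

/-- ★ **`E∘D*₁` IS FIRST ORDER**: `E∘D*₁ = −Σ_ν P1a_ν∘∇_ν` (no product rule needed: `D*₁` is already a sum of flat derivatives). [cite: Balaban1985BackgroundPropagators, (3.75) p.405] -/
theorem EgY_comp_divY_one (V : CfgY 𝔸 i) :
    EgY i V ∘ₗ divY i (fun _ _ => (1 : 𝔸ˣ)) = -∑ ν, P1aY i V ν ∘ₗ nablaY i ν := by
  refine LinearMap.ext fun A => funext fun b => ?_
  obtain ⟨s, κ⟩ := b
  have key : ∀ g : Fin (d + 1) → 𝔸, ((i.cf : ℝ) : ℂ) • (R (V κ s) (-∑ μ, g μ) - -∑ μ, g μ) =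
      -∑ μ, ((i.cf : ℝ) : ℂ) • (R (V κ s) (g μ) - g μ) := by
    intro g
    rw [R_neg, R_finset_sum, sub_neg_eq_add, neg_add_eq_sub, smul_sub, Finset.smul_sum, Finset.smul_sum, ← Finset.sum_sub_distrib,
      ← Finset.sum_neg_distrib]
    refine Finset.sum_congr rfl fun μ _ => ?_
    rw [smul_sub, neg_sub]
  rw [LinearMap.comp_apply, EgY_apply_mk, divY_one_apply_chartY, key]
  simp only [LinearMap.neg_apply, Pi.neg_apply, LinearMap.coe_sum, Finset.sum_apply, LinearMap.comp_apply, P1aY_apply_mk]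

/-- **the `V⁰`-word of `−D₁∘E*` (variation of the inverse transporter in the output direction)**:
`(P0a A)(⟨s, κ⟩) = −c_f²·Σ_μ (R(V_μ(s+e_κ−e_μ))⁻¹ − R(V_μ(s−e_μ))⁻¹) A(⟨s+e_κ−e_μ, μ⟩)` (print's `i ad_{(D_μA_ν)}` terms of (3.75)).
[cite: Balaban1985BackgroundPropagators, (3.75) p.405, (3.73) p.405] -/
def P0aY (V : CfgY 𝔸 i) : (FBondY i → 𝔸) →ₗ[ℂ] (FBondY i → 𝔸) where
  toFun A := fun b => -((((i.cf : ℝ) : ℂ) * ((i.cf : ℝ) : ℂ)) • ∑ μ : Fin (d + 1),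
    (R (V μ ((b.src.shift b.dir).unshift μ))⁻¹ (A ⟨(b.src.shift b.dir).unshift μ, μ⟩) - R (V μ (b.src.unshift μ))⁻¹ (A ⟨(b.src.shift b.dir).unshift μ, μ⟩)))
  map_add' A A' := by
    funext b
    simp only [Pi.add_apply, R_add, ← neg_add, ← smul_add, ← Finset.sum_add_distrib]
    congr 2
    refine Finset.sum_congr rfl fun μ _ => ?_
    abel
  map_smul' c A := by
    funext b
    simp only [Pi.smul_apply, R_smul, RingHom.id_apply, ← smul_sub, ← Finset.smul_sum, smul_neg]
    rw [smul_comm c]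

/-- `P0a` evaluated at `⟨s, κ⟩`. [cite: Balaban1985BackgroundPropagators, (3.75) p.405, bookkeeping] -/
theorem P0aY_apply_mk (V : CfgY 𝔸 i) (A : FBondY i → 𝔸) (s : Site (PV d ℓ i.m i.K hd hL) 0) (κ : Fin (d + 1)) :
    P0aY i V A ⟨s, κ⟩ = -((((i.cf : ℝ) : ℂ) * ((i.cf : ℝ) : ℂ)) • ∑ μ : Fin (d + 1),
      (R (V μ ((s.shift κ).unshift μ))⁻¹ (A ⟨(s.shift κ).unshift μ, μ⟩) - R (V μ (s.unshift μ))⁻¹ (A ⟨(s.shift κ).unshift μ, μ⟩))) := rfl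

/-- **the `V¹`-words of `−D₁∘E*`**: `(P1b_νY)(⟨s, κ⟩) = −[ν = κ]·c_f·Σ_μ (R(V_μ(s−e_μ))⁻¹ − 1)Y(⟨s−e_μ, μ⟩)` (to be composed with `∇_ν`; print's `i ad_A·(D_μA′_ν)` terms of
(3.75)). [cite: Balaban1985BackgroundPropagators, (3.75) p.405, (3.73) p.405] -/
def P1bY (V : CfgY 𝔸 i) (ν : Fin (d + 1)) : (FBondY i → 𝔸) →ₗ[ℂ] (FBondY i → 𝔸) where
  toFun Y := fun b => if ν = b.dir then -(((i.cf : ℝ) : ℂ) • ∑ μ : Fin (d + 1),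
    (R (V μ (b.src.unshift μ))⁻¹ (Y ⟨b.src.unshift μ, μ⟩) - Y ⟨b.src.unshift μ, μ⟩)) else 0
  map_add' Y Y' := by
    funext b
    simp only [Pi.add_apply, R_add]
    split_ifs
    · rw [← neg_add, ← smul_add, ← Finset.sum_add_distrib]
      congr 2
      refine Finset.sum_congr rfl fun μ _ => ?_
      abel
    · simp
  map_smul' c Y := by
    funext b
    simp only [Pi.smul_apply, R_smul, RingHom.id_apply]
    split_ifs
    · simp only [← smul_sub, ← Finset.smul_sum, smul_neg]
      rw [smul_comm c]
    · simp

/-- `P1b_ν` evaluated at `⟨s, κ⟩`. [cite: Balaban1985BackgroundPropagators, (3.75) p.405, bookkeeping] -/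
theorem P1bY_apply_mk (V : CfgY 𝔸 i) (ν : Fin (d + 1)) (Y : FBondY i → 𝔸) (s : Site (PV d ℓ i.m i.K hd hL) 0) (κ : Fin (d + 1)) :
    P1bY i V ν Y ⟨s, κ⟩ = if ν = κ then -(((i.cf : ℝ) : ℂ) • ∑ μ : Fin (d + 1),
      (R (V μ (s.unshift μ))⁻¹ (Y ⟨s.unshift μ, μ⟩) - Y ⟨s.unshift μ, μ⟩)) else 0 := rfl

/-- ★★ **THE PRODUCT RULE OF (3.75)**: `D₁∘E* = −P0a − Σ_ν P1b_ν∘∇_ν` — the outer flat difference in direction `κ` of `c_f(R(V_μ(y))⁻¹ − 1)A(⟨y, μ⟩)`, `y = s − e_μ`, falls on the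
coefficient (VARIATION of the inverse transporter, one more `c_f`) or on `A` (`(R(V)⁻¹ − 1)·∇_κA`), the `c_f`'s cancelling as in print. [cite: Balaban1985BackgroundPropagators, (3.75) p.405] -/
theorem gradY_one_comp_EdY (V : CfgY 𝔸 i) :
    gradY i (fun _ _ => (1 : 𝔸ˣ)) ∘ₗ EdY i V = -P0aY i V - ∑ ν, P1bY i V ν ∘ₗ nablaY i ν := by
  refine LinearMap.ext fun A => funext fun b => ?_
  obtain ⟨s, κ⟩ := b
  -- the right side at `⟨s, κ⟩`: only `ν = κ` contributes
  have hR : (-P0aY i V - ∑ ν, P1bY i V ν ∘ₗ nablaY i ν) A ⟨s, κ⟩ =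
      (((i.cf : ℝ) : ℂ) * ((i.cf : ℝ) : ℂ)) • ∑ μ : Fin (d + 1),
        (R (V μ ((s.shift κ).unshift μ))⁻¹ (A ⟨(s.shift κ).unshift μ, μ⟩) - R (V μ (s.unshift μ))⁻¹ (A ⟨(s.shift κ).unshift μ, μ⟩)) +
      ((i.cf : ℝ) : ℂ) • ∑ μ : Fin (d + 1),
        (R (V μ (s.unshift μ))⁻¹ (nablaY i κ A ⟨s.unshift μ, μ⟩) - nablaY i κ A ⟨s.unshift μ, μ⟩) := by
    simp only [LinearMap.sub_apply, LinearMap.neg_apply, Pi.sub_apply, Pi.neg_apply, LinearMap.coe_sum, Finset.sum_apply, P0aY_apply_mk, neg_neg,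
      LinearMap.comp_apply, P1bY_apply_mk, Finset.sum_ite_eq', Finset.mem_univ, if_true, sub_neg_eq_add]
  rw [hR, LinearMap.comp_apply, gradY_one_apply_mk, EdY_apply_chartY, EdY_apply_chartY, smul_sub, smul_smul, smul_smul, Finset.smul_sum, Finset.smul_sum,
    Finset.smul_sum, Finset.smul_sum, ← Finset.sum_sub_distrib, ← Finset.sum_add_distrib]
  refine Finset.sum_congr rfl fun μ _ => ?_
  rw [nablaY_apply, unshift_shift_comm, R_smul, R_sub]
  change (((i.cf : ℝ) : ℂ) * ((i.cf : ℝ) : ℂ)) • (R (V μ ((s.shift κ).unshift μ))⁻¹ (A ⟨(s.shift κ).unshift μ, μ⟩) - A ⟨(s.shift κ).unshift μ, μ⟩) -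
      (((i.cf : ℝ) : ℂ) * ((i.cf : ℝ) : ℂ)) • (R (V μ (s.unshift μ))⁻¹ (A ⟨s.unshift μ, μ⟩) - A ⟨s.unshift μ, μ⟩) = _
  module

/-! ## §3  ★★★ `D₁D*₁ − D_VD*_V = P⁰ + Σ_ν P¹_ν∘∇_ν` and its realification -/

/-- **the zeroth-order part `P⁰` of `D₁D*₁ − D_VD*_V`**: `P0a − E∘E*` (variation word; product of two small factors). [cite: Balaban1985BackgroundPropagators, (3.75) p.405, (3.73) p.405] -/
def P0Y (V : CfgY 𝔸 i) : (FBondY i → 𝔸) →ₗ[ℂ] (FBondY i → 𝔸) := P0aY i V - EgY i V ∘ₗ EdY i V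

/-- **the first-order words `P¹_ν` of `D₁D*₁ − D_VD*_V`**: `P1a_ν + P1b_ν`. [cite: Balaban1985BackgroundPropagators, (3.75) p.405, (3.73) p.405] -/
def P1Y (V : CfgY 𝔸 i) (ν : Fin (d + 1)) : (FBondY i → 𝔸) →ₗ[ℂ] (FBondY i → 𝔸) := P1aY i V ν + P1bY i V ν

/-- ★★★ **(3.75) AT def-Y'S LETTERS: THE GRADIENT–DIVERGENCE DIFFERENCE IS A LOCAL FIRST-ORDER OPERATOR IN THE FLAT BOND DERIVATIVES**,
`D₁D*₁ − D_VD*_V = P⁰ + Σ_ν P¹_ν∘∇_ν`, with the explicit letters `P0Y`, `P1Y` (whose (3.73)-sizes under the (3.37) windows are part II's business).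
[cite: Balaban1985BackgroundPropagators, (3.74)–(3.75) p.405, (3.73) p.405, (3.82) p.407] -/
theorem gradDiv_one_sub_gradDiv_eq (V : CfgY 𝔸 i) :
    gradY i (fun _ _ => (1 : 𝔸ˣ)) ∘ₗ divY i (fun _ _ => 1) - gradY i V ∘ₗ divY i V = P0Y i V + ∑ ν, P1Y i V ν ∘ₗ nablaY i ν := by
  rw [gradDiv_one_sub_gradDiv_eq_neg, EgY_comp_divY_one, gradY_one_comp_EdY, P0Y]
  have e : ∑ ν, P1Y i V ν ∘ₗ nablaY i ν = ∑ ν, P1aY i V ν ∘ₗ nablaY i ν + ∑ ν, P1bY i V ν ∘ₗ nablaY i ν := by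
    rw [← Finset.sum_add_distrib]
    refine Finset.sum_congr rfl fun ν _ => ?_
    rw [P1Y, LinearMap.add_comp]
  rw [e]
  abel

/-- ★★★ **REALIFIED, IN G-F5's CURRENCY**: `conj b((D₁D*₁ − D_VD*_V)^ℝ) = conj b(P⁰^ℝ) + Σ_ν conj b(P¹_ν^ℝ)·DK b i ν` — the gradient–divergence half of the projection piece
`projPieceK` in the `V⁰ + Σ V¹·DK` shape of `cor35_G_cube_of_pieces`' Laplacian input. [cite: Balaban1985BackgroundPropagators, (3.75) p.405, (3.82)–(3.85) p.407; Balaban1984PropagatorsII, (2.51) p.232] -/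
theorem conj_gradDiv_one_sub_gradDiv_eq {ιb : Type} [Fintype ιb] (b : Module.Basis ιb ℝ 𝔸) (V : CfgY 𝔸 i) :
    B9Eq352DivFormLetters.conj b ((gradY i (fun _ _ => (1 : 𝔸ˣ)) ∘ₗ divY i (fun _ _ => 1) - gradY i V ∘ₗ divY i V).restrictScalars ℝ) =
      B9Eq352DivFormLetters.conj b ((P0Y i V).restrictScalars ℝ) +
        ∑ ν, B9Eq352DivFormLetters.conj b ((P1Y i V ν).restrictScalars ℝ) * DK b i ν := by
  rw [gradDiv_one_sub_gradDiv_eq]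
  have e : ((P0Y i V + ∑ ν, P1Y i V ν ∘ₗ nablaY i ν).restrictScalars ℝ) =
      (P0Y i V).restrictScalars ℝ + ∑ ν, (P1Y i V ν).restrictScalars ℝ * (nablaY i ν).restrictScalars ℝ := by
    refine LinearMap.ext fun X => ?_
    simp only [LinearMap.restrictScalars_apply, LinearMap.add_apply, LinearMap.coe_sum, Finset.sum_apply, Module.End.mul_apply,
      LinearMap.comp_apply]
  rw [e, conj_add'', conj_finset_sum]
  congr 1
  refine Finset.sum_congr rfl fun ν _ => ?_
  rw [B9Eq352DivFormLetters.conj_mul]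
  rfl

end Literature.MathematicalPhysics.QuantumFieldTheory.Balaban1983to89.B9Eq375GradDivSplitY

end
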